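import Summits.ValiantsHypothesis.ValiantsHypothesis.Theorems.LacunarySymmetroidMatrixDescartesLagrangeTowerAlternation

/-!
# `MatrixDescartes` census — arrowhead Lagrange tower: the kernel frame of the arrowhead and `tower_good`

HONEST FRAMING.  Object-search cell `pub-symmetroid`, crux `Theses.LacunarySymmetroid.MatrixDescartes`
(stmt-ValiantsHypothesis-18050); seat val-sym-mdr-p1 (g2).  Part of the kernel port of the cell's THEOREM L (conjb-3 g3, ROUND3-MEMO §1;
paper-checked by conjb-1 g2 and theory g21) in the arrowhead / secular form of `…LagrangeTowerDefs`: for EVERY `m ≥ 1` some real symmetric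
three-term lacunary `m × m` pencil has `C(m+2,2) − 1` distinct positive determinant roots, so `KThreeColumnLaw` (CONJECTURE A3) holds.
This is a LOWER-bound / Descartes-extremality statement for the thin `K = 3` column (CONJECTURE-A currency); it proves nothing about
the crux `MatrixDescartes` (an upper-bound statement at fat formats) and nothing about `VP ≠ VNP`.  No definitions in this file.

THIS FILE. The explicit kernel vectors `kvec i` of the arrowhead pencil at the parent roots (`flat_mulVec_kvec`), their
`Bflat`-orthogonality from symmetry and distinct roots (`kvec_B_kvec_offdiag`), `Vflatᵀ (Aflat + x Bflat) Vflat = diagonal (βnew (x − z))`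
(`Vflat_pencil_Vflat`); transport to the bordered letters of `step` through `W ⊕ 1` (`stepA_conj`, `stepB_conj`), the new split frame
(`step_hdiag`) and `Wᵀ U = 1` (`step_hWU`, no matrix inverse is ever taken: `U_new = (U ⊕ 1)·Bflat·V·diagonal(βnew⁻¹)`); hence
`step_good : d.Good → (step d).Good` and `tower_good : ∀ k, (tower k).Good`. [folklore]
-/

-- `Summit.ValiantsHypothesis.ValiantsHypothesis.…` repeats a component by the D-0017 layout
-- (single-conjunct summit), which the `dupNamespace` linter flags; the name is mandated.
set_option linter.dupNamespace false

namespace Summit.ValiantsHypothesis.ValiantsHypothesis.Theorems.LacunarySymmetroidMatrixDescartes.Census.LagrangeTower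

open Matrix Polynomial Finset
open scoped BigOperators

section Frame

variable {k : ℕ} (d : TowerData k)

/-- `(Vᵀ M V) i j = (column i of V) ⬝ (M · column j of V)`. -/
theorem transpose_mul_mul_apply {p n : Type*} [Fintype p] [Fintype n] (V : Matrix p n ℝ) (M : Matrix p p ℝ) (i j : n) :
    (Vᵀ * M * V) i j = (fun q => V q i) ⬝ᵥ (M *ᵥ fun q => V q j) := by
  simp only [Matrix.mul_apply, Matrix.transpose_apply, dotProduct, Matrix.mulVec, Finset.sum_mul,
    Finset.mul_sum]
  rw [Finset.sum_comm]
  exact Finset.sum_congr rfl fun a _ => Finset.sum_congr rfl fun b _ => by ring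

/-- The arrowhead constant letter is symmetric. -/
theorem Aflat_isSymm : (Aflat d).IsSymm := by
  unfold Matrix.IsSymm Aflat
  rw [Matrix.fromBlocks_transpose, Matrix.diagonal_transpose, Matrix.transpose_replicateCol,
    Matrix.transpose_replicateRow]
  congr 1

/-- The arrowhead linear letter is symmetric. -/
theorem Bflat_isSymm : (Bflat d).IsSymm := by
  unfold Matrix.IsSymm Bflat
  rw [Matrix.fromBlocks_transpose, Matrix.diagonal_transpose, Matrix.transpose_zero, Matrix.transpose_zero]
  congr 1

/-- symmetric matrices: `v ⬝ (M w) = w ⬝ (M v)`. -/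
theorem dotProduct_mulVec_symm {p : Type*} [Fintype p] {M : Matrix p p ℝ} (hM : M.IsSymm) (v w : p → ℝ) :
    v ⬝ᵥ (M *ᵥ w) = w ⬝ᵥ (M *ᵥ v) := by
  rw [Matrix.dotProduct_mulVec, ← Matrix.mulVec_transpose, hM, dotProduct_comm]

/-- **Kernel vectors**: `(Aflat + z_i • Bflat) · v_i = 0`. -/
theorem flat_mulVec_kvec (halt : ∀ l : Fin k, 0 < d.θ * (-1) ^ (l : ℕ) * d.β l) (i : Fin (k + 1)) :
    (Aflat d + zroot (k + 1) i • Bflat d) *ᵥ kvec d i = 0 := by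
  have hψ := ψfun_root d halt i
  unfold Aflat Bflat kvec
  rw [Matrix.fromBlocks_smul, Matrix.fromBlocks_add, Matrix.fromBlocks_mulVec]
  funext p
  rcases p with l | u
  · simp only [Sum.elim_inl, Pi.add_apply, smul_zero, add_zero, Pi.zero_apply]
    have hβ := β_ne_zero d halt l
    have hz : zroot (k + 1) i - zroot k l ≠ 0 := sub_ne_zero.mpr (zroot_succ_lt k i l).ne
    rw [show (Sum.elim (fun l => -cvec d l / (d.β l * (zroot (k + 1) i - zroot k l))) (fun _ => (1 : ℝ))) ∘ Sum.inl
        = fun l => -cvec d l / (d.β l * (zroot (k + 1) i - zroot k l)) from rfl,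
      show (Sum.elim (fun l => -cvec d l / (d.β l * (zroot (k + 1) i - zroot k l))) (fun _ => (1 : ℝ))) ∘ Sum.inr
        = fun _ => (1 : ℝ) from rfl]
    rw [← Matrix.diagonal_smul, Matrix.diagonal_add, Matrix.mulVec_diagonal]
    simp only [Matrix.mulVec, dotProduct, Matrix.replicateCol_apply, Fin.sum_univ_one, mul_one, Pi.smul_apply,
      smul_eq_mul]
    field_simp
    ring
  · simp only [Sum.elim_inr, Pi.add_apply, Pi.zero_apply]
    rw [show (Sum.elim (fun l => -cvec d l / (d.β l * (zroot (k + 1) i - zroot k l))) (fun _ => (1 : ℝ))) ∘ Sum.inl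
        = fun l => -cvec d l / (d.β l * (zroot (k + 1) i - zroot k l)) from rfl,
      show (Sum.elim (fun l => -cvec d l / (d.β l * (zroot (k + 1) i - zroot k l))) (fun _ => (1 : ℝ))) ∘ Sum.inr
        = fun _ => (1 : ℝ) from rfl]
    simp only [Matrix.mulVec, dotProduct, Matrix.replicateRow_apply, Matrix.add_apply, Matrix.smul_apply,
      Matrix.of_apply, Matrix.zero_apply, smul_eq_mul, mul_zero, add_zero, Fin.sum_univ_one, mul_one]
    -- this is `ψ(z_i) = 0`
    unfold ψfun at hψ
    rw [eval_Lpoly] at hψ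
    have hβ := fun l => β_ne_zero d halt l
    have : ∑ x, cvec d x * (-cvec d x / (d.β x * (zroot (k + 1) i - zroot k x)))
        = -∑ l, cvec d l ^ 2 / d.β l / (zroot (k + 1) i - zroot k l) := by
      rw [← Finset.sum_neg_distrib]
      refine Finset.sum_congr rfl fun l _ => ?_
      have hz : zroot (k + 1) i - zroot k l ≠ 0 := sub_ne_zero.mpr (zroot_succ_lt k i l).ne
      field_simp
    rw [this]
    linear_combination hψ

/-- `v_i ⬝ (Bflat v_j) = 0` for `i ≠ j` (symmetry + distinct roots). -/
theorem kvec_B_kvec_offdiag (halt : ∀ l : Fin k, 0 < d.θ * (-1) ^ (l : ℕ) * d.β l) {i j : Fin (k + 1)} (hij : i ≠ j) :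
    kvec d i ⬝ᵥ (Bflat d *ᵥ kvec d j) = 0 := by
  have hi := flat_mulVec_kvec d halt i
  have hj := flat_mulVec_kvec d halt j
  have hsymm : (Aflat d + zroot (k + 1) i • Bflat d).IsSymm := by
    unfold Matrix.IsSymm
    rw [Matrix.transpose_add, Matrix.transpose_smul, Aflat_isSymm, Bflat_isSymm]
  -- 0 = v_j ⬝ (G(z_i) v_i) = v_i ⬝ (G(z_i) v_j) = v_i ⬝ (G(z_j) v_j) + (z_i - z_j) v_i ⬝ (B v_j)
  have h1 : kvec d j ⬝ᵥ ((Aflat d + zroot (k + 1) i • Bflat d) *ᵥ kvec d i) = 0 := by rw [hi, dotProduct_zero]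
  rw [dotProduct_mulVec_symm hsymm] at h1
  have h2 : (Aflat d + zroot (k + 1) i • Bflat d)
      = (Aflat d + zroot (k + 1) j • Bflat d) + (zroot (k + 1) i - zroot (k + 1) j) • Bflat d := by
    rw [sub_smul]; abel
  rw [h2, Matrix.add_mulVec, dotProduct_add, hj, dotProduct_zero, zero_add, Matrix.smul_mulVec,
    dotProduct_smul, smul_eq_mul] at h1
  have hz : zroot (k + 1) i - zroot (k + 1) j ≠ 0 := sub_ne_zero.mpr fun h => hij (zroot_injective _ h)
  exact (mul_eq_zero.mp h1).resolve_left hz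

/-- `Bflat · v_i`, explicitly. -/
theorem Bflat_mulVec_kvec (i : Fin (k + 1)) :
    Bflat d *ᵥ kvec d i
      = Sum.elim (fun l => d.β l * (-cvec d l / (d.β l * (zroot (k + 1) i - zroot k l)))) (fun _ => ηnew d * lslope k) := by
  unfold Bflat kvec
  rw [Matrix.fromBlocks_mulVec]
  funext p
  rcases p with l | u
  · simp only [Sum.elim_inl, Matrix.zero_mulVec, add_zero]
    rw [show (Sum.elim (fun l => -cvec d l / (d.β l * (zroot (k + 1) i - zroot k l))) (fun _ => (1 : ℝ))) ∘ Sum.inl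
        = fun l => -cvec d l / (d.β l * (zroot (k + 1) i - zroot k l)) from rfl, Matrix.mulVec_diagonal]
  · simp only [Sum.elim_inr, Matrix.zero_mulVec, zero_add]
    rw [show (Sum.elim (fun l => -cvec d l / (d.β l * (zroot (k + 1) i - zroot k l))) (fun _ => (1 : ℝ))) ∘ Sum.inr
        = fun _ => (1 : ℝ) from rfl]
    simp only [Matrix.mulVec, dotProduct, Matrix.of_apply, Fin.sum_univ_one, mul_one]

/-- `v_i ⬝ (Bflat v_i) = βnew i`. -/
theorem kvec_B_kvec_diag (halt : ∀ l : Fin k, 0 < d.θ * (-1) ^ (l : ℕ) * d.β l) (i : Fin (k + 1)) :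
    kvec d i ⬝ᵥ (Bflat d *ᵥ kvec d i) = βnew d i := by
  rw [Bflat_mulVec_kvec]
  unfold kvec βnew ψder
  rw [sumElim_dotProduct_sumElim]
  simp only [dotProduct, Fin.sum_univ_one, one_mul]
  rw [add_comm]
  congr 1
  refine Finset.sum_congr rfl fun l _ => ?_
  have hβ := β_ne_zero d halt l
  have hz : zroot (k + 1) i - zroot k l ≠ 0 := sub_ne_zero.mpr (zroot_succ_lt k i l).ne
  field_simp

/-- `v_i ⬝ (Aflat v_j) = −z_j · v_i ⬝ (Bflat v_j)`. -/
theorem kvec_A_kvec (halt : ∀ l : Fin k, 0 < d.θ * (-1) ^ (l : ℕ) * d.β l) (i j : Fin (k + 1)) :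
    kvec d i ⬝ᵥ (Aflat d *ᵥ kvec d j) = -(zroot (k + 1) j * (kvec d i ⬝ᵥ (Bflat d *ᵥ kvec d j))) := by
  have hj := flat_mulVec_kvec d halt j
  rw [Matrix.add_mulVec, Matrix.smul_mulVec] at hj
  have : Aflat d *ᵥ kvec d j = -(zroot (k + 1) j • (Bflat d *ᵥ kvec d j)) := eq_neg_of_add_eq_zero_left hj
  rw [this, dotProduct_neg, dotProduct_smul, smul_eq_mul]

/-- **The kernel frame diagonalises the arrowhead**: `Vflatᵀ Bflat Vflat = diagonal βnew`. -/
theorem Vflat_B_Vflat (halt : ∀ l : Fin k, 0 < d.θ * (-1) ^ (l : ℕ) * d.β l) :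
    (Vflat d)ᵀ * Bflat d * Vflat d = diagonal (βnew d) := by
  ext i j
  rw [transpose_mul_mul_apply]
  change kvec d i ⬝ᵥ (Bflat d *ᵥ kvec d j) = _
  by_cases hij : i = j
  · subst hij; rw [Matrix.diagonal_apply_eq, kvec_B_kvec_diag d halt]
  · rw [Matrix.diagonal_apply_ne _ hij, kvec_B_kvec_offdiag d halt hij]

/-- `Vflatᵀ Aflat Vflat = diagonal (−βnew·z)`. -/
theorem Vflat_A_Vflat (halt : ∀ l : Fin k, 0 < d.θ * (-1) ^ (l : ℕ) * d.β l) :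
    (Vflat d)ᵀ * Aflat d * Vflat d = diagonal (fun i => -(βnew d i * zroot (k + 1) i)) := by
  ext i j
  rw [transpose_mul_mul_apply]
  change kvec d i ⬝ᵥ (Aflat d *ᵥ kvec d j) = _
  rw [kvec_A_kvec d halt]
  by_cases hij : i = j
  · subst hij; rw [Matrix.diagonal_apply_eq, kvec_B_kvec_diag d halt]; ring
  · rw [Matrix.diagonal_apply_ne _ hij, kvec_B_kvec_offdiag d halt hij]; ring

/-- In Sum coordinates the arrowhead pencil is diagonalised with the designed parent roots. -/
theorem Vflat_pencil_Vflat (halt : ∀ l : Fin k, 0 < d.θ * (-1) ^ (l : ℕ) * d.β l) (x : ℝ) :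
    (Vflat d)ᵀ * (Aflat d + x • Bflat d) * Vflat d = diagonal (fun i => βnew d i * (x - zroot (k + 1) i)) := by
  rw [Matrix.mul_add, Matrix.add_mul, Matrix.mul_smul, Matrix.smul_mul, Vflat_A_Vflat d halt,
    Vflat_B_Vflat d halt, ← Matrix.diagonal_smul, Matrix.diagonal_add]
  congr 1
  funext i
  simp only [Pi.smul_apply, smul_eq_mul]
  ring

end Frame

section StepGood

variable {k : ℕ} (d : TowerData k)

/-- On a good level, `Wᵀ A W = diagonal (−β·zroot)`. -/
theorem W_A_W (hd : d.Good) : d.Wᵀ * d.A * d.W = diagonal (fun l => -(d.β l * zroot k l)) := by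
  have h := hd.2.2.1 0
  rw [zero_smul, add_zero] at h
  rw [h]
  congr 1; funext l; ring

/-- On a good level, `Wᵀ B W = diagonal β`. -/
theorem W_B_W (hd : d.Good) : d.Wᵀ * d.B * d.W = diagonal d.β := by
  have h0 := hd.2.2.1 0
  have h1 := hd.2.2.1 1
  rw [zero_smul, add_zero] at h0
  rw [one_smul, Matrix.mul_add, Matrix.add_mul, h0] at h1
  have : d.Wᵀ * d.B * d.W = diagonal (fun i => d.β i * (1 - zroot k i)) - diagonal (fun i => d.β i * (0 - zroot k i)) :=
    eq_sub_of_add_eq' h1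
  rw [this, Matrix.diagonal_sub]
  congr 1; funext l; ring

/-- Re-indexing through `finSumFinEquiv` is multiplicative. -/
theorem reindex_mul_reindex (X Y : Matrix (Fin k ⊕ Fin 1) (Fin k ⊕ Fin 1) ℝ) :
    Matrix.reindex finSumFinEquiv finSumFinEquiv X * Matrix.reindex finSumFinEquiv finSumFinEquiv Y
      = Matrix.reindex (finSumFinEquiv : Fin k ⊕ Fin 1 ≃ Fin (k + 1)) finSumFinEquiv (X * Y) := by
  simp [Matrix.reindex_apply]

/-- `(M ⊕ 1)ᵀ = Mᵀ ⊕ 1`. -/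
theorem transpose_extendOne (M : Matrix (Fin k) (Fin k) ℝ) : (extendOne M)ᵀ = extendOne Mᵀ := by
  unfold extendOne
  rw [Matrix.transpose_reindex, Matrix.fromBlocks_transpose, Matrix.transpose_zero, Matrix.transpose_zero,
    Matrix.transpose_one]

/-- Conjugating the bordered constant letter by `W ⊕ 1` gives the arrowhead letter `Aflat`. -/
theorem stepA_conj (hd : d.Good) :
    (extendOne d.W)ᵀ * (step d).A * extendOne d.W
      = Matrix.reindex (finSumFinEquiv : Fin k ⊕ Fin 1 ≃ Fin (k + 1)) finSumFinEquiv (Aflat d) := by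
  rw [transpose_extendOne]
  unfold extendOne
  change Matrix.reindex _ _ _ * Matrix.reindex finSumFinEquiv finSumFinEquiv
      (Matrix.fromBlocks d.A (replicateCol (Fin 1) (bvec d)) (replicateRow (Fin 1) (bvec d))
        (Matrix.of fun _ _ => ηnew d * lconst k)) * _ = _
  rw [reindex_mul_reindex, reindex_mul_reindex]
  congr 1
  rw [Matrix.fromBlocks_multiply, Matrix.fromBlocks_multiply]
  simp only [Matrix.zero_mul, Matrix.mul_zero, add_zero, zero_add, Matrix.one_mul, Matrix.mul_one]
  unfold Aflat
  have hWU : d.Wᵀ * d.U = 1 := hd.2.1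
  have hcol : d.Wᵀ * replicateCol (Fin 1) (bvec d) = replicateCol (Fin 1) (cvec d) := by
    unfold bvec
    rw [← Matrix.replicateCol_mulVec, Matrix.mulVec_mulVec, hWU, Matrix.one_mulVec]
  have hrow : replicateRow (Fin 1) (bvec d) * d.W = replicateRow (Fin 1) (cvec d) := by
    unfold bvec
    rw [← Matrix.replicateRow_vecMul, ← Matrix.mulVec_transpose, Matrix.mulVec_mulVec, hWU, Matrix.one_mulVec]
  rw [W_A_W d hd, hcol, hrow]

/-- Conjugating the bordered linear letter by `W ⊕ 1` gives the arrowhead letter `Bflat`. -/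
theorem stepB_conj (hd : d.Good) :
    (extendOne d.W)ᵀ * (step d).B * extendOne d.W
      = Matrix.reindex (finSumFinEquiv : Fin k ⊕ Fin 1 ≃ Fin (k + 1)) finSumFinEquiv (Bflat d) := by
  rw [transpose_extendOne]
  unfold extendOne
  change Matrix.reindex _ _ _ * Matrix.reindex finSumFinEquiv finSumFinEquiv
      (Matrix.fromBlocks d.B 0 0 (Matrix.of fun _ _ => ηnew d * lslope k)) * _ = _
  rw [reindex_mul_reindex, reindex_mul_reindex]
  congr 1
  rw [Matrix.fromBlocks_multiply, Matrix.fromBlocks_multiply]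
  simp only [Matrix.zero_mul, Matrix.mul_zero, add_zero, zero_add, Matrix.one_mul, Matrix.mul_one]
  unfold Bflat
  rw [W_B_W d hd]

/-- Un-reindexing the frame: `Vsqᵀ (reindex M) Vsq = Vflatᵀ M Vflat`. -/
theorem Vsq_conj (M : Matrix (Fin k ⊕ Fin 1) (Fin k ⊕ Fin 1) ℝ) :
    (Vsq d)ᵀ * Matrix.reindex (finSumFinEquiv : Fin k ⊕ Fin 1 ≃ Fin (k + 1)) finSumFinEquiv M * Vsq d
      = (Vflat d)ᵀ * M * Vflat d := by
  unfold Vsq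
  rw [Matrix.transpose_submatrix, Matrix.reindex_apply, Matrix.submatrix_mul_equiv, Matrix.submatrix_mul_equiv,
    Matrix.submatrix_id_id]

/-- Re-indexing through `finSumFinEquiv` is linear. -/
theorem reindex_add_smul (X Y : Matrix (Fin k ⊕ Fin 1) (Fin k ⊕ Fin 1) ℝ) (x : ℝ) :
    Matrix.reindex (finSumFinEquiv : Fin k ⊕ Fin 1 ≃ Fin (k + 1)) finSumFinEquiv (X + x • Y)
      = Matrix.reindex finSumFinEquiv finSumFinEquiv X + x • Matrix.reindex finSumFinEquiv finSumFinEquiv Y := by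
  ext i j; simp [Matrix.reindex_apply]

/-- `W_newᵀ = Vsqᵀ (W ⊕ 1)ᵀ`. -/
theorem step_W_transpose : (step d).Wᵀ = (Vsq d)ᵀ * (extendOne d.W)ᵀ := by
  change (extendOne d.W * Vsq d)ᵀ = _
  rw [Matrix.transpose_mul]

/-- **The new frame diagonalises the bordered pencil with the designed parent roots.** -/
theorem step_hdiag (hd : d.Good) (x : ℝ) :
    (step d).Wᵀ * ((step d).A + x • (step d).B) * (step d).W
      = diagonal (fun i => (step d).β i * (x - zroot (k + 1) i)) := by
  rw [step_W_transpose]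
  change (Vsq d)ᵀ * (extendOne d.W)ᵀ * ((step d).A + x • (step d).B) * (extendOne d.W * Vsq d)
      = diagonal (fun i => βnew d i * (x - zroot (k + 1) i))
  have hA := stepA_conj d hd
  have hB := stepB_conj d hd
  have : (Vsq d)ᵀ * (extendOne d.W)ᵀ * ((step d).A + x • (step d).B) * (extendOne d.W * Vsq d)
      = (Vsq d)ᵀ * Matrix.reindex (finSumFinEquiv : Fin k ⊕ Fin 1 ≃ Fin (k + 1)) finSumFinEquiv
          (Aflat d + x • Bflat d) * Vsq d := by
    rw [reindex_add_smul, ← hA, ← hB]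
    simp only [Matrix.mul_add, Matrix.add_mul, Matrix.mul_smul, Matrix.smul_mul, Matrix.mul_assoc]
  rw [this, Vsq_conj, Vflat_pencil_Vflat d hd.2.2.2]

/-- **`Wᵀ U = 1` for the new level.** -/
theorem step_hWU (hd : d.Good) : (step d).Wᵀ * (step d).U = 1 := by
  rw [step_W_transpose]
  change (Vsq d)ᵀ * (extendOne d.W)ᵀ *
      (extendOne d.U * Matrix.reindex finSumFinEquiv finSumFinEquiv (Bflat d) * Vsq d *
        diagonal (fun i => (βnew d i)⁻¹)) = 1
  have hWU : (extendOne d.W)ᵀ * extendOne d.U = 1 := by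
    rw [transpose_extendOne]
    unfold extendOne
    rw [reindex_mul_reindex, Matrix.fromBlocks_multiply]
    simp only [Matrix.zero_mul, Matrix.mul_zero, add_zero, zero_add, Matrix.mul_one, hd.2.1,
      Matrix.fromBlocks_one]
    simp [Matrix.reindex_apply]
  have hβ : ∀ i, βnew d i ≠ 0 := by
    intro i h
    have := βnew_alt d hd.2.2.2 hd.1 i
    rw [h, mul_zero] at this
    exact lt_irrefl _ this
  calc (Vsq d)ᵀ * (extendOne d.W)ᵀ *
      (extendOne d.U * Matrix.reindex finSumFinEquiv finSumFinEquiv (Bflat d) * Vsq d *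
        diagonal (fun i => (βnew d i)⁻¹))
      = (Vsq d)ᵀ * (((extendOne d.W)ᵀ * extendOne d.U) *
          Matrix.reindex finSumFinEquiv finSumFinEquiv (Bflat d)) * Vsq d *
          diagonal (fun i => (βnew d i)⁻¹) := by
        simp only [Matrix.mul_assoc]
    _ = ((Vsq d)ᵀ * Matrix.reindex finSumFinEquiv finSumFinEquiv (Bflat d) * Vsq d) *
          diagonal (fun i => (βnew d i)⁻¹) := by rw [hWU, Matrix.one_mul]
    _ = diagonal (βnew d) * diagonal (fun i => (βnew d i)⁻¹) := by rw [Vsq_conj, Vflat_B_Vflat d hd.2.2.2]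
    _ = 1 := by
        rw [Matrix.diagonal_mul_diagonal, ← Matrix.diagonal_one]
        congr 1; funext i; exact mul_inv_cancel₀ (hβ i)

/-- **THE BORDERING STEP PRESERVES THE SPLIT-FRAME IDENTITIES.** -/
theorem step_good (hd : d.Good) : (step d).Good := by
  refine ⟨ηnew_cases d hd.1, step_hWU d hd, step_hdiag d hd, ?_⟩
  intro i
  exact βnew_alt d hd.2.2.2 hd.1 i

/-- The empty level is good. -/
theorem towerZero_good : towerZero.Good := by
  refine ⟨Or.inl rfl, by simp [towerZero], fun x => ?_, fun i => i.elim0⟩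
  ext i j; exact i.elim0

/-- **Every level of the tower is good.** -/
theorem tower_good : ∀ k : ℕ, (tower k).Good
  | 0 => towerZero_good
  | k + 1 => step_good (tower k) (tower_good k)

end StepGood

end Summit.ValiantsHypothesis.ValiantsHypothesis.Theorems.LacunarySymmetroidMatrixDescartes.Census.LagrangeTower
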